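import Summits.KontsevichZagierPeriods.KontsevichZagierPeriods.Theorems.LinRedNormalFormArrangementNormalFormStubRebaseSimplePosManyBlow

/-!
# Stub `stub_rebaseSimplePosMany`, part `rebaseSimplePosMany_product` (crux `ArrangementNormalForm`, line `janus-bands`) — `Above`

The case analysis for ONE lettered fibre `i` of a product representation over a base of
dimension `B + 1` lying ABOVE its letter, the other fibres riding along as spectators: the
`K`-fibre, spectator-transparent port of the uniformly closed cases of the one-fibre tree
(`RebasePos.good_thickBand`, `good_belowApex`, `good_levelSplit`, `good_coaxial`,
`good_aboveApexNear`, `good_above_of_residual`). The letter has been sheared to `0`, the bounds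
`u = Uᵢ < v = Vᵢ` are transverse to it in `y` and `0 < u < v` on the base cell:
* THICK bands (`v − u ≥ c₀ > 0`): Janus extension up to a constant level (`RebaseMany.good_thickBand`);
* parallel bounds (`u_y = v_y`): RESIDUAL (`RebaseMany.IsResidual`, first kind);
* otherwise the apex level `κ = u − A (v − u)`, `A = u_y/(v_y − u_y)`, is `y`-free:
  `A < −1` (band below its apex level): Janus extension up to `κ` (`RebaseMany.good_belowApex`);
  `−1 < A < 0` (apex level between the bounds): cut the fibre at `κ` (`RebaseMany.good_levelCut`);
  `A > 0`, `κ = 0`: coaxial blow-up (`RebaseMany.good_coaxial`); `A > 0`, `κ ≠ 0`: cut the base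
  cell by the signs of `κ` and `v − 2κ` (rule 1a): `{κ > 0, v < 2κ}` is the NEAR regime
  (`RebaseMany.good_nearApex`, Janus extension down to `κ`), `{κ < 0}` and `{κ > 0, v ≥ 2κ}` are
  RESIDUAL (second and third kind).
The residual configurations are delegated to a RESIDUAL CONTINUATION hypothesis `RebaseMany.HRc`
(same shape as `RebaseMany.HPc`: the fibre `i` residual instead of in format, spectators
unchanged, base cell shrunk); the assembly `RebaseMany.good_above` with the compactness
dichotomy (thick unless a pinch / corner point lies in the closed cell) is part `Corner`.
Registered: `rebaseSimplePosMany_thickBand`.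

References: M. Kontsevich, D. Zagier, *Periods* (2001), §1.2, rules (1a), (2).
-/

noncomputable section

open Set MeasureTheory MvPolynomial
open Literature.NumberTheory.Transcendental Literature.ModelTheory.ExponentialFields

namespace Summit.KontsevichZagierPeriods.ArrangementNormalForm.JanusBands

namespace RebaseMany

open SeparatePos RebasePos

variable {B K : ℕ}

/-! ### Residual configurations -/

/-- The three RESIDUAL configurations of a fibre with letter `0` and bounds `u < v` over the base
cell `cell K M` (those the spectator-transparent moves do not close uniformly in `x'`):
PARALLEL transverse bounds above the letter whose closed base cell `{rows ≥ 0}` contains a PINCH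
POINT (`0 ≤ u = v`); a band above its apex level `κ` with the apex level BELOW the letter
(`κ < 0 < u < v`, `u − κ = A (v − u)`, `A > 0`), or above its apex level `κ > 0` in the FAR regime
`v ≥ 2κ`, whose closed base cell contains a CORNER POINT (`κ = u = v = 0`: the apex of the band on
the letter). Bands without pinch / corner point are thick (part `Corner`). [folklore] -/
def IsResidual (K : ℕ) {m' : ℕ} (M : Fin m' → Cf B) (u v : Cf B) : Prop :=
  (u.1 (Fin.last B) ≠ 0 ∧ u.1 (Fin.last B) = v.1 (Fin.last B) ∧
      (∀ z ∈ cell K M, 0 < affF B K u z ∧ affF B K u z < affF B K v z) ∧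
      ∃ z : Fin (B + 1 + K) → ℝ, (∀ j, 0 ≤ affF B K (M j) z) ∧ 0 ≤ affF B K u z ∧
        affF B K u z = affF B K v z) ∨
    ∃ (κ : Cf B) (A : ℚ), κ.1 (Fin.last B) = 0 ∧ u - κ = A • (v - u) ∧ 0 < A ∧
      (∃ z : Fin (B + 1 + K) → ℝ, (∀ j, 0 ≤ affF B K (M j) z) ∧ affF B K κ z = 0 ∧
        affF B K u z = 0 ∧ affF B K v z = 0) ∧
      ((∀ z ∈ cell K M, affF B K κ z < 0 ∧ 0 < affF B K u z ∧ affF B K u z < affF B K v z) ∨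
        (∀ z ∈ cell K M, 0 < affF B K κ z ∧ affF B K u z < affF B K v z ∧
          2 * affF B K κ z ≤ affF B K v z))

/-- The RESIDUAL CONTINUATION hypothesis for the fibre `i` over sub-cells of `cell K M₀`: every
product representation (same `T`) over a base cell contained in `cell K M₀` whose fibre `i` has
letter `0` and is residual, and whose other fibres carry the data `(a, U, V)`, is good. [folklore] -/
def HRc (T : BData B) (i : Fin K) {m₀ : ℕ} (M₀ : Fin m₀ → Cf B) (U V : Fin K → Cf B)
    (a : Fin K → Option (Cf B)) : Prop :=
  ∀ (m' : ℕ) (s : KZ.IntegralRep (B + 1 + K)) (M : Fin m' → Cf B) (U' V' : Fin K → Cf B)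
    (p : MvPolynomial (Fin B) ℚ) (a' : Fin K → Option (Cf B)), IsProd s M U' V' T p a' →
    cell K M ⊆ cell K M₀ → a' i = some 0 → IsResidual K M (U' i) (V' i) →
    (∀ j, j ≠ i → a' j = a j ∧ U' j = U j ∧ V' j = V j) → Good B K (KZ.of s)

/-- The residual continuation hypothesis passes to smaller base cells. [folklore] -/
theorem HRc.mono {T : BData B} {i : Fin K} {m₀ m₁ : ℕ} {M₀ : Fin m₀ → Cf B} {M₁ : Fin m₁ → Cf B}
    {U V : Fin K → Cf B} {a : Fin K → Option (Cf B)} (hR : HRc T i M₀ U V a)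
    (hsub : cell K M₁ ⊆ cell K M₀) : HRc T i M₁ U V a :=
  fun m' s M U' V' p a' h hM ha hres hs => hR m' s M U' V' p a' h (hM.trans hsub) ha hres hs

/-- The residual continuation hypothesis only sees the spectator fibres. [folklore] -/
theorem HRc.transfer {T : BData B} {i : Fin K} {m₀ : ℕ} {M₀ : Fin m₀ → Cf B} {U V U' V' : Fin K → Cf B}
    {a a' : Fin K → Option (Cf B)} (hR : HRc T i M₀ U V a)
    (hsame : ∀ j, j ≠ i → a' j = a j ∧ U' j = U j ∧ V' j = V j) : HRc T i M₀ U' V' a' :=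
  fun m' s M U'' V'' p a'' h hM ha hres hs =>
  hR m' s M U'' V'' p a'' h hM ha hres fun j hj => by
    obtain ⟨h1, h2, h3⟩ := hs j hj
    obtain ⟨h1', h2', h3'⟩ := hsame j hj
    exact ⟨h1.trans h1', h2.trans h2', h3.trans h3'⟩

/-- **Using the residual continuation hypothesis.** [folklore] -/
theorem HRc.apply {T : BData B} {i : Fin K} {m₀ : ℕ} {M₀ : Fin m₀ → Cf B} {U V : Fin K → Cf B}
    {a : Fin K → Option (Cf B)} (hR : HRc T i M₀ U V a) {s : KZ.IntegralRep (B + 1 + K)} {m' : ℕ}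
    {M : Fin m' → Cf B} {U' V' : Fin K → Cf B} {p : MvPolynomial (Fin B) ℚ} {a' : Fin K → Option (Cf B)}
    (h : IsProd s M U' V' T p a') (hM : cell K M ⊆ cell K M₀) (ha : a' i = some 0)
    (hres : IsResidual K M (U' i) (V' i)) (hs : ∀ j, j ≠ i → a' j = a j ∧ U' j = U j ∧ V' j = V j) :
    Good B K (KZ.of s) :=
  hR _ s M U' V' p a' h hM ha hres hs

section Above

variable {s : KZ.IntegralRep (B + 1 + K)} {m' : ℕ} {M : Fin m' → Cf B} {U V : Fin K → Cf B}
  {T : BData B} {p : MvPolynomial (Fin B) ℚ} {a : Fin K → Option (Cf B)}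

/-- A rational constant dominating an atom on the base cell of a product representation. [folklore] -/
theorem exists_cst_gt (h : IsProd s M U V T p a) (v : Cf B) :
    ∃ K₀ : ℚ, 0 < K₀ ∧ ∀ z ∈ cell K M, |affF B K v z| < K₀ := by
  obtain ⟨R, hR⟩ := h.cbd
  obtain ⟨K₀, hK₀⟩ := exists_rat_gt (max ((∑ j, |(v.1 j : ℝ)|) * |R| + |(v.2 : ℝ)|) 0)
  refine ⟨K₀, by exact_mod_cast (le_max_right _ _).trans_lt hK₀, fun z hz => ?_⟩
  have hb := abs_affF_le (K := K) v (fun j => (hR z hz j).trans (le_abs_self R))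
  exact (hb.trans (le_max_left _ _)).trans_lt hK₀

/-- The letter `0` has `y`-slope `0`: a `y`-free level is parallel to it. [folklore] -/
theorem yfree_of_letter_zero (i : Fin K) (ha : a i = some 0) (κ : Cf B) (hκ : κ.1 (Fin.last B) = 0) :
    ∀ c : Cf B, a i = some c → κ.1 (Fin.last B) = c.1 (Fin.last B) := fun c hc => by
  rw [ha] at hc
  cases hc
  simpa using hκ

/-- **A thick band above its letter.** Fibre `i` with letter `0` and bounds `0 < u < v` on the
base cell whose thickness is bounded below there (`u + c₀ ≤ v`, `c₀ > 0` a constant) is good,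
given the continuation hypothesis: Janus extension of the upper bound up to a CONSTANT level
`K₀ > sup v` (rule 1a; the upper wedge is dominated, `RebaseMany.janus_up_dom` with
`λ = c₁/(2K₀)`, `c₁ < c₀` rational); both pieces have the `y`-free upper bound `K₀`, hence are
terminal. -/
theorem good_thickBand (h : IsProd s M U V T p a) (i : Fin K) (ha : a i = some 0)
    (hP : HPc T i M U V a) (c₀ : ℝ) (hc₀ : 0 < c₀)
    (hcell : ∀ z ∈ cell K M, 0 < affF B K (U i) z ∧ affF B K (U i) z + c₀ ≤ affF B K (V i) z) :
    Good B K (KZ.of s) := by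
  obtain ⟨K₀, hK₀pos, hK₀⟩ := exists_cst_gt h (V i)
  obtain ⟨c₁, hc₁0, hc₁⟩ := exists_rat_btwn hc₀
  have hc₁0' : (0 : ℚ) < c₁ := by exact_mod_cast hc₁0
  set lam : ℚ := c₁ / (2 * K₀) with hlam
  have hlam0 : 0 < lam := div_pos hc₁0' (by positivity)
  have hlamK : (lam : ℝ) * (2 * K₀) = c₁ := by
    rw [hlam]
    push_cast
    field_simp
  obtain ⟨sT, sW, hT, hW, hrel⟩ := janus_up_dom h i 0 ha (cst B K₀) lam hlam0 fun z hz => by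
    obtain ⟨hu0, huv⟩ := hcell z hz
    have hvb := hK₀ z hz
    rw [abs_lt] at hvb
    rw [affF_zero, affF_cst]
    refine ⟨hu0.le, by linarith, hvb.2.le, ?_⟩
    have h1 : (K₀ : ℝ) - affF B K (V i) z ≤ 2 * K₀ := by linarith
    have h2 : (lam : ℝ) * ((K₀ : ℝ) - affF B K (V i) z) ≤ (lam : ℝ) * (2 * K₀) :=
      mul_le_mul_of_nonneg_left h1 (by exact_mod_cast hlam0.le)
    linarith
  have h0 := yfree_of_letter_zero i ha (cst B K₀) rfl
  refine good_of_janus hrel ?_ ?_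
  · exact good_terminal hT i (hP.transfer fun j hj => ⟨rfl, rfl, Function.update_of_ne hj _ _⟩)
      fun c hc => Or.inr (by rw [Function.update_self]; exact h0 c hc)
  · exact good_terminal hW i (hP.transfer fun j hj =>
        ⟨rfl, Function.update_of_ne hj _ _, Function.update_of_ne hj _ _⟩)
      fun c hc => Or.inr (by rw [Function.update_self]; exact h0 c hc)

/-- The apex relation evaluated: `u − κ = A (v − u)`. [folklore] -/
theorem affF_apex {u v κ : Cf B} {A : ℚ} (hA : u - κ = A • (v - u)) (z : Fin (B + 1 + K) → ℝ) :
    affF B K u z - affF B K κ z = (A : ℝ) * (affF B K v z - affF B K u z) := by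
  have key := congrArg (fun q => affF B K q z) hA
  simp only [affF_sub, affF_smul] at key
  exact key

/-- **Band between its letter and its apex level** (`0 < u < v < κ`: `u − κ = A (v − u)` with
`A + 1 < 0`, `κ` `y`-free): Janus extension of the upper bound up to `κ`; the upper wedge is
dominated (`λ = (−(A + 1))⁻¹`); both pieces have the `y`-free upper bound `κ`. -/
theorem good_belowApex (h : IsProd s M U V T p a) (i : Fin K) (ha : a i = some 0)
    (hP : HPc T i M U V a) (κ : Cf B) (A : ℚ) (hκ : κ.1 (Fin.last B) = 0)
    (hA : U i - κ = A • (V i - U i)) (hA1 : A + 1 < 0)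
    (hcell : ∀ z ∈ cell K M, 0 < affF B K (U i) z ∧ affF B K (U i) z < affF B K (V i) z) :
    Good B K (KZ.of s) := by
  have huκ := affF_apex (K := K) hA
  have hvκ : ∀ z : Fin (B + 1 + K) → ℝ, affF B K (V i) z - affF B K κ z =
      ((A : ℝ) + 1) * (affF B K (V i) z - affF B K (U i) z) := fun z => by linarith [huκ z]
  have hA1' : (A : ℝ) + 1 < 0 := by exact_mod_cast hA1
  set lam : ℚ := (-(A + 1))⁻¹ with hlam_def
  have hlam : 0 < lam := inv_pos.2 (by linarith)
  have hlamR : (lam : ℝ) * (-((A : ℝ) + 1)) = 1 := by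
    rw [hlam_def, Rat.cast_inv, Rat.cast_neg, Rat.cast_add, Rat.cast_one]
    exact inv_mul_cancel₀ (neg_ne_zero.2 hA1'.ne)
  obtain ⟨sT, sW, hT, hW, hrel⟩ := janus_up_dom h i 0 ha κ lam hlam fun z hz => by
    obtain ⟨hu0, huv⟩ := hcell z hz
    rw [affF_zero]
    refine ⟨hu0.le, huv.le, by nlinarith [hvκ z], le_of_eq ?_⟩
    linear_combination (-(lam : ℝ)) * hvκ z + (affF B K (V i) z - affF B K (U i) z) * hlamR
  have h0 := yfree_of_letter_zero i ha κ hκ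
  refine good_of_janus hrel ?_ ?_
  · exact good_terminal hT i (hP.transfer fun j hj => ⟨rfl, rfl, Function.update_of_ne hj _ _⟩)
      fun c hc => Or.inr (by rw [Function.update_self]; exact h0 c hc)
  · exact good_terminal hW i (hP.transfer fun j hj =>
        ⟨rfl, Function.update_of_ne hj _ _, Function.update_of_ne hj _ _⟩)
      fun c hc => Or.inr (by rw [Function.update_self]; exact h0 c hc)

/-- **Band above its apex level, near regime** (`0 < κ ≤ u < v ≤ C κ`: `u − κ = A (v − u)`
with `A > 0`, `κ` `y`-free): Janus extension of the lower bound down to `κ`; the lower wedge is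
dominated (`RebaseMany.janus_down_dom` with `λ = A⁻¹`); both pieces have the `y`-free lower
bound `κ`. -/
theorem good_nearApex (h : IsProd s M U V T p a) (i : Fin K) (ha : a i = some 0)
    (hP : HPc T i M U V a) (κ : Cf B) (A : ℚ) (C : ℝ) (hκ : κ.1 (Fin.last B) = 0)
    (hA : U i - κ = A • (V i - U i)) (hA0 : 0 < A)
    (hcell : ∀ z ∈ cell K M, 0 < affF B K κ z ∧ affF B K (U i) z < affF B K (V i) z ∧
      affF B K (V i) z ≤ C * affF B K κ z) : Good B K (KZ.of s) := by
  have huκ := affF_apex (K := K) hA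
  have hA0' : (0 : ℝ) < A := by exact_mod_cast hA0
  obtain ⟨sT, sW, hT, hW, hrel⟩ := janus_down_dom h i 0 ha κ A⁻¹ C (inv_pos.2 hA0) fun z hz => by
    obtain ⟨hκ0, huv, hvC⟩ := hcell z hz
    rw [affF_zero, sub_zero, sub_zero]
    refine ⟨hκ0.le, by nlinarith [huκ z], huv.le, le_of_eq ?_, hvC⟩
    rw [huκ z, Rat.cast_inv, ← mul_assoc, inv_mul_cancel₀ hA0'.ne', one_mul]
  have h0 := yfree_of_letter_zero i ha κ hκ
  refine good_of_janus hrel ?_ ?_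
  · exact good_terminal hT i (hP.transfer fun j hj => ⟨rfl, Function.update_of_ne hj _ _, rfl⟩)
      fun c hc => Or.inl (by rw [Function.update_self]; exact h0 c hc)
  · exact good_terminal hW i (hP.transfer fun j hj =>
        ⟨rfl, Function.update_of_ne hj _ _, Function.update_of_ne hj _ _⟩)
      fun c hc => Or.inl (by rw [Function.update_self]; exact h0 c hc)

end Above

end RebaseMany

/-- Registered support goal of this file: a THICK lettered fibre (letter `0`, `0 < Uᵢ`,
`Uᵢ + c₀ ≤ Vᵢ` on the base cell) of a product representation over a base of dimension `B + 1` is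
good, given the continuation hypothesis over sub-cells (`RebaseMany.good_thickBand`). -/
theorem rebaseSimplePosMany_thickBand (B K m' : ℕ) (s : KZ.IntegralRep (B + 1 + K)) (M : Fin m' → (Fin (B + 1) → ℚ) × ℚ) (U V : Fin K → (Fin (B + 1) → ℚ) × ℚ) (T : RebaseMany.BData B) (p : MvPolynomial (Fin B) ℚ) (a : Fin K → Option ((Fin (B + 1) → ℚ) × ℚ)) (h : RebaseMany.IsProd s M U V T p a) (i : Fin K) (ha : a i = some 0) (hP : RebaseMany.HPc T i M U V a) (c₀ : ℝ) (hc₀ : 0 < c₀) (hcell : ∀ z ∈ RebaseMany.cell K M, 0 < SeparatePos.affF B K (U i) z ∧ SeparatePos.affF B K (U i) z + c₀ ≤ SeparatePos.affF B K (V i) z) : RebaseMany.Good B K (KZ.of s) :=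
  RebaseMany.good_thickBand h i ha hP c₀ hc₀ hcell

end Summit.KontsevichZagierPeriods.ArrangementNormalForm.JanusBands
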